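import Summits.Ventures.KdS.RouteWTransfer
import Literature.Geometry.Lorentzian.KerrDeSitterAccessoryIdentity
import HarnessLib

/-!
# Venture KdS — ROUTE W: `K_A` (`RouteW.Transfer`) holds

HONEST FRAMING (venture `Summits/Ventures/KdS`, cell `pub-kds`): the residual algebraic identity
`RouteW.AccessoryIdentity` of `RouteWTransfer.lean` is LIT-1 g5's Literature theorem
`KerrDeSitter.mobiusQ_hatsuda_eq_eulerGaugeQ` (Hatsuda's accessory quantity through the Möbius
automorphism = the Euler-gauge accessory parameter of Casals–Teixeira da Costa's masses, via
`vieta_sq`); hence `transfer_holds : RouteW.Transfer`. With `gaugeGlue_holds` and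
`swappedEnergyVanishing_holds`, three of the five hypotheses of `RouteW.prop38_of_routeW` are now
theorems; the remaining ones are `EulerRL` (analysis, cell memo theory/ROUTE-W-EULERRL-PLAN.md) and
`SpinFlip` (vacuous for `s < 1`). Nothing about Kerr–de Sitter modes is claimed beyond that.
-/

noncomputable section

namespace Summit.Ventures.KdS

namespace RouteW

open Literature.Geometry.Lorentzian Literature.Geometry.Lorentzian.KerrDeSitter

/-- The residual identity of `K_A` holds (LIT-1's `mobiusQ_hatsuda_eq_eulerGaugeQ`; all of
`mass_j`, `bigE`, `ltBlock`, `zTwo` unfold definitionally). -/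
theorem accessoryIdentity_holds : AccessoryIdentity := by
  intro M a Λ s ω m lam hsub
  exact mobiusQ_hatsuda_eq_eulerGaugeQ hsub s ω m lam

/-- **K_A of route W holds**: every generic-boundary radial Teukolsky mode transfers to Euler-gauge
Heun mode data on `(1, z₂)` (CTdC Lemma 3.5 at the level of solutions). -/
theorem transfer_holds : Transfer :=
  transfer_of_accessoryIdentity accessoryIdentity_holds

end RouteW

end Summit.Ventures.KdS
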